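import Summits.Ventures.HodgeRepro2.T5SU11SphericalODE

/-!
# Differentiability of the spherical functions of `SU(1,1)` in the parameter:
`∂_λ φ_λ(a_t) = -(1/2) (2π)⁻¹ ∫_{-π}^{π} B^{-λ/2} log B dφ`, `∂_λ φ_λ |_{λ=1} = 0`, and
`∫_{-π}^{π} B^{-1/2} log B dφ = 0`

Differentiating Laplace's integral `sph λ (a_t) = (2π)⁻¹ ∫_{-π}^{π} B^{-λ/2} dφ`
(`B = cosh 2t − sinh 2t cos φ > 0`) in the **parameter** `λ` with the lemma
`T5SU11SphericalDeriv.hasDerivAt_intervalIntegral_of_continuous` (`∂_λ B^{-λ/2} = B^{-λ/2} log B · (-1/2)`,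
`hasDerivAt_rpow_param`; joint continuity in `(λ, φ)`) gives
**`∂_λ sph λ (a_t) = (2π)⁻¹ ∫ B^{-λ/2} log B · (-1/2) dφ`** (`hasDerivAt_sph_hyp_param`), so
`λ ↦ sph λ g` is differentiable on `ℝ` for every `g` (`differentiable_sph_param`, `deriv_sph_param`).
Since `sph 1 g ≤ sph λ g` for every `λ` (`T5SU11SphericalBounds.sph_one_le`: `Ξ` is the minimum), Fermat's
rule gives **`∂_λ sph λ g |_{λ=1} = 0`** (`deriv_sph_param_one`), and in Laplace's form the integral
identity **`∫_{-π}^{π} (cosh 2t − sinh 2t cos φ)^{-1/2} log (cosh 2t − sinh 2t cos φ) dφ = 0`** for every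
`t` (`integral_laplace_rpow_neg_half_mul_log`) — the analytic shadow of the functional equation
`φ_λ = φ_{2-λ}` at its fixed point `λ = ρ`. Nothing is claimed about (N).

Blind lane: Mathlib + the HodgeRepro2 prefix only; no sorry; axioms ⊆ {propext, Classical.choice,
Quot.sound}.
-/

namespace Summit.Ventures.HodgeRepro2.T5SU11SphericalParamDeriv

open MeasureTheory Metric Set Filter Topology Complex intervalIntegral
open T5SU11Unimodular T5SU11Fibration T5SU11Cartan T5SU11OneParameter T5SU11CartanProjection
  T5HaarCircle T5BergmanCoefficient T5SU11SphericalFunction T5SU11SphericalTwo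
  T5SU11SphericalSymmetry T5SU11SphericalBounds T5SU11SphericalContinuous
  T5SU11SphericalAsymptotic T5SU11SphericalLp T5SU11SphericalCfun T5SU11SphericalLpSharp
  T5SU11SphericalXiLog T5SU11SphericalCfunLimit T5SU11SphericalStrict T5SU11SphericalDeriv
  T5SU11SphericalODE
open scoped Real

/-! ### The parameter derivative of `B^{-λ/2}` -/

/-- `∂_λ b^{-λ/2} = b^{-λ/2} · log b · (-1/2)` for `b > 0`. -/
lemma hasDerivAt_rpow_param {b : ℝ} (hb : 0 < b) (lam : ℝ) :
    HasDerivAt (fun lam : ℝ => b ^ (-lam / 2)) (b ^ (-lam / 2) * Real.log b * (-1 / 2)) lam := by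
  have hinner : HasDerivAt (fun lam : ℝ => -lam / 2) (-1 / 2) lam := by
    simpa using (hasDerivAt_id' (x := lam)).neg.div_const 2
  exact ((Real.hasStrictDerivAt_const_rpow hb (-lam / 2)).hasDerivAt).comp lam hinner

/-- `(λ, φ) ↦ B(t, φ)^{-λ/2}` is continuous. -/
lemma continuous_laplace_rpow_param (t : ℝ) :
    Continuous fun p : ℝ × ℝ => (Real.cosh (2 * t) - Real.sinh (2 * t) * Real.cos p.2) ^ (-p.1 / 2) :=
  (continuous_laplace_base_phi t |>.comp continuous_snd).rpow (by fun_prop)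
    fun p => Or.inl (laplace_base_pos t p.2).ne'

/-- `(λ, φ) ↦ B(t, φ)^{-λ/2} · log B(t, φ) · (-1/2)` is continuous. -/
lemma continuous_laplace_rpow_param_deriv (t : ℝ) :
    Continuous fun p : ℝ × ℝ =>
      (Real.cosh (2 * t) - Real.sinh (2 * t) * Real.cos p.2) ^ (-p.1 / 2) *
        Real.log (Real.cosh (2 * t) - Real.sinh (2 * t) * Real.cos p.2) * (-1 / 2) :=
  ((continuous_laplace_rpow_param t).mul
    ((continuous_laplace_base_phi t |>.comp continuous_snd).log
      fun p => (laplace_base_pos t p.2).ne')).mul continuous_const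

/-- **The parameter derivative of Laplace's integral**:
`∂_λ ∫_{-π}^{π} B^{-λ/2} dφ = ∫_{-π}^{π} B^{-λ/2} log B · (-1/2) dφ`. -/
theorem hasDerivAt_integral_laplace_param (t lam₀ : ℝ) :
    HasDerivAt (fun lam => ∫ φ in (-π)..π,
        (Real.cosh (2 * t) - Real.sinh (2 * t) * Real.cos φ) ^ (-lam / 2))
      (∫ φ in (-π)..π, (Real.cosh (2 * t) - Real.sinh (2 * t) * Real.cos φ) ^ (-lam₀ / 2) *
        Real.log (Real.cosh (2 * t) - Real.sinh (2 * t) * Real.cos φ) * (-1 / 2)) lam₀ :=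
  hasDerivAt_intervalIntegral_of_continuous
    (fun lam φ => (Real.cosh (2 * t) - Real.sinh (2 * t) * Real.cos φ) ^ (-lam / 2))
    (fun lam φ => (Real.cosh (2 * t) - Real.sinh (2 * t) * Real.cos φ) ^ (-lam / 2) *
      Real.log (Real.cosh (2 * t) - Real.sinh (2 * t) * Real.cos φ) * (-1 / 2))
    (continuous_laplace_rpow_param t) (continuous_laplace_rpow_param_deriv t)
    (fun lam φ => hasDerivAt_rpow_param (laplace_base_pos t φ) lam) lam₀

section measure

variable [MeasurableSpace Circle] [BorelSpace Circle]

/-- **The parameter derivative of `λ ↦ sph λ (a_t)`**: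
`∂_λ sph λ (a_t) = (2π)⁻¹ ∫_{-π}^{π} B^{-λ/2} log B · (-1/2) dφ`. -/
theorem hasDerivAt_sph_hyp_param (t lam₀ : ℝ) :
    HasDerivAt (fun lam => sph lam (hyp t))
      ((2 * π)⁻¹ * ∫ φ in (-π)..π,
        (Real.cosh (2 * t) - Real.sinh (2 * t) * Real.cos φ) ^ (-lam₀ / 2) *
          Real.log (Real.cosh (2 * t) - Real.sinh (2 * t) * Real.cos φ) * (-1 / 2)) lam₀ := by
  have e : (fun lam => sph lam (hyp t)) = fun lam => (2 * π)⁻¹ * ∫ φ in (-π)..π,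
      (Real.cosh (2 * t) - Real.sinh (2 * t) * Real.cos φ) ^ (-lam / 2) := by
    funext lam
    exact sph_hyp_eq_laplace lam t
  rw [e]
  exact (hasDerivAt_integral_laplace_param t lam₀).const_mul _

/-- **`λ ↦ sph λ g` is differentiable on `ℝ`** for every `g`. -/
theorem differentiable_sph_param (g : SU11) : Differentiable ℝ fun lam => sph lam g := by
  have e : (fun lam => sph lam g) = fun lam => sph lam (hyp (cartanT g)) := by
    funext lam
    exact sph_eq_sph_hyp_cartanT lam g
  rw [e]
  exact fun lam => (hasDerivAt_sph_hyp_param (cartanT g) lam).differentiableAt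

/-- **The parameter derivative in closed form.** -/
theorem deriv_sph_hyp_param (t lam₀ : ℝ) :
    deriv (fun lam => sph lam (hyp t)) lam₀ =
      (2 * π)⁻¹ * ∫ φ in (-π)..π,
        (Real.cosh (2 * t) - Real.sinh (2 * t) * Real.cos φ) ^ (-lam₀ / 2) *
          Real.log (Real.cosh (2 * t) - Real.sinh (2 * t) * Real.cos φ) * (-1 / 2) :=
  (hasDerivAt_sph_hyp_param t lam₀).deriv

/-- **Fermat at the critical parameter**: `∂_λ sph λ g |_{λ=1} = 0` (`Ξ = sph 1` is the minimum of
`λ ↦ sph λ g`). -/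
theorem deriv_sph_param_one (g : SU11) : deriv (fun lam => sph lam g) 1 = 0 :=
  IsLocalMin.deriv_eq_zero (Filter.Eventually.of_forall fun lam => sph_one_le lam g)

/-- **The integral identity at `λ = 1`**:
`∫_{-π}^{π} (cosh 2t − sinh 2t cos φ)^{-1/2} log (cosh 2t − sinh 2t cos φ) dφ = 0` for every `t`. -/
theorem integral_laplace_rpow_neg_half_mul_log (t : ℝ) :
    ∫ φ in (-π)..π, (Real.cosh (2 * t) - Real.sinh (2 * t) * Real.cos φ) ^ (-(1 : ℝ) / 2) *
      Real.log (Real.cosh (2 * t) - Real.sinh (2 * t) * Real.cos φ) = 0 := by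
  have hπ := Real.pi_pos
  have h := deriv_sph_param_one (hyp t)
  rw [deriv_sph_hyp_param, intervalIntegral.integral_mul_const] at h
  have h2 : (2 * π)⁻¹ * (-1 / 2) ≠ 0 := by
    apply mul_ne_zero (by positivity)
    norm_num
  have h3 : (2 * π)⁻¹ * ((∫ φ in (-π)..π,
      (Real.cosh (2 * t) - Real.sinh (2 * t) * Real.cos φ) ^ (-(1 : ℝ) / 2) *
        Real.log (Real.cosh (2 * t) - Real.sinh (2 * t) * Real.cos φ)) * (-1 / 2)) =
      (2 * π)⁻¹ * (-1 / 2) * ∫ φ in (-π)..π,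
      (Real.cosh (2 * t) - Real.sinh (2 * t) * Real.cos φ) ^ (-(1 : ℝ) / 2) *
        Real.log (Real.cosh (2 * t) - Real.sinh (2 * t) * Real.cos φ) := by ring
  rw [h3] at h
  exact (mul_eq_zero.mp h).resolve_left h2

end measure

end Summit.Ventures.HodgeRepro2.T5SU11SphericalParamDeriv
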